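import Summits.ABC.IUTFork.Joshi.ArchimedeanOstrowski
import Mathlib.Topology.Instances.Complex

/-!
# Ostrowski's theorem, complete case: a field complete for an archimedean absolute value is `(ℝ, |·|^s)` or `(ℂ, ‖·‖^s)`
# (proof-only; corollary of `Joshi/ArchimedeanOstrowski.lean`)

Proof-only companion file of the abc-iut cell, branch E «type Joshi's construction, test vs S» (rung LADDER-ABC:A2.E;
seat abc-iut-E-t38, gen 4; lineage slot T-38 = [J-II½] arXiv:2305.10398v12 §2.3). `Joshi/ArchimedeanOstrowski.lean`
(p448108) proves that an absolute value `v` on a field `K` which is not non-archimedean is `‖ι(·)‖^s` for a field embedding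
`ι : K →+* ℂ` and `0 < s ≤ 1`. THIS FILE adds the classical complete case — the sentence recorded as TODO in Mathlib's
`Analysis/Normed/Algebra/GelfandMazur.lean` («any field that is complete with respect to an archimedean absolute value is
isomorphic to either `ℝ` or `ℂ` as a field with absolute value»):

* `isUniformInducing_ringHom_of_rpow_eq` — if `v = ‖ι(·)‖^s` then `ι : (K, v) → ℂ` is uniformly bicontinuous onto its
  image (Hölder both ways), so for complete `(K, v)` the image is closed (`isClosed_range_ringHom_of_rpow_eq`);
* `exists_ringEquiv_real_or_complex_of_completeSpace` (**Ostrowski 1916, complete archimedean fields**): if moreover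
  `K` is complete for `v` (Mathlib: `CompleteSpace (WithAbs v)`), then EITHER `K ≃+* ℝ` with `v = |e(·)|^s` OR `K ≃+* ℂ`
  with `v = ‖e(·)‖^s` — by Mathlib's `Complex.subfield_eq_of_closed` (the closed subfields of `ℂ` are `ℝ` and `ℂ`);
* `exists_ringEquiv_complex_of_completeSpace_of_sq_eq_neg_one` — the `ℂ` alternative as soon as `-1` is a square in `K`
  (e.g. `K` algebraically closed): the shape of [J-II½] Def. 2.3.2 «archimedean algebraically closed perfectoid field :=
  valued field isomorphic to `(ℂ, |−|^s_ℂ)`» — i.e. Def. 2.3.2 names exactly the complete archimedean valued fields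
  containing `√-1` (a remark, not a claim of print; recorded for the E-lit dictionary).

FRAMING. Standard mathematics; no Joshi-specific content beyond the remark above; no `def`, no hypothesis `Prop`, nothing
of the cell's frozen interface imported. No side is taken on [IUTchIII] Cor. 3.12 or on any author; typed ≠ proved.
Standard axioms only; sorry-free. bears_on: LADDER-ABC:A2.E
-/

set_option autoImplicit false

noncomputable section

open Filter Topology

namespace Summit.ABC.IUTFork.Joshi.ArchimedeanOstrowski

variable {K : Type*} [Field K]

/-- If `v = ‖ι(·)‖^s` (`s > 0`), the embedding `ι`, seen on the normed field `(K, v) = WithAbs v`, is UNIFORMLY INDUCING into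
`ℂ`: distances correspond by `d_ℂ = d_v^{1/s}` (Hölder in both directions). [folklore] -/
theorem isUniformInducing_ringHom_of_rpow_eq (v : AbsoluteValue K ℝ) (ι : K →+* ℂ) {s : ℝ} (hs : 0 < s)
    (h : ∀ x, v x = ‖ι x‖ ^ s) :
    IsUniformInducing (fun a : WithAbs v => ι (WithAbs.ofAbs a)) := by
  have hdist : ∀ a b : WithAbs v,
      dist (ι (WithAbs.ofAbs a)) (ι (WithAbs.ofAbs b)) = (dist a b) ^ s⁻¹ := by
    intro a b
    rw [dist_eq_norm, dist_eq_norm, ← map_sub, WithAbs.norm_eq_apply_ofAbs, WithAbs.ofAbs_sub, h,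
      Real.rpow_rpow_inv (norm_nonneg _) hs.ne']
  refine Metric.isUniformInducing_iff.mpr ⟨?_, ?_⟩
  · refine Metric.uniformContinuous_iff.mpr fun ε hε => ⟨ε ^ s, Real.rpow_pos_of_pos hε s, ?_⟩
    intro a b hab
    rw [hdist]
    calc (dist a b) ^ s⁻¹ < (ε ^ s) ^ s⁻¹ := Real.rpow_lt_rpow dist_nonneg hab (inv_pos.mpr hs)
      _ = ε := Real.rpow_rpow_inv hε.le hs.ne'
  · intro δ hδ
    refine ⟨δ ^ s⁻¹, Real.rpow_pos_of_pos hδ _, ?_⟩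
    intro a b hab
    rw [hdist] at hab
    calc dist a b = ((dist a b) ^ s⁻¹) ^ s := (Real.rpow_inv_rpow dist_nonneg hs.ne').symm
      _ < (δ ^ s⁻¹) ^ s := Real.rpow_lt_rpow (Real.rpow_nonneg dist_nonneg _) hab hs
      _ = δ := Real.rpow_inv_rpow hδ.le hs.ne'

/-- Hence, if `(K, v)` is complete, the image `ι(K) ⊆ ℂ` is closed. [folklore] -/
theorem isClosed_range_ringHom_of_rpow_eq (v : AbsoluteValue K ℝ) [CompleteSpace (WithAbs v)] (ι : K →+* ℂ)
    {s : ℝ} (hs : 0 < s) (h : ∀ x, v x = ‖ι x‖ ^ s) : IsClosed (Set.range ι) := by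
  have hrange : Set.range (fun a : WithAbs v => ι (WithAbs.ofAbs a)) = Set.range ι := by
    ext z
    constructor
    · rintro ⟨a, rfl⟩; exact ⟨WithAbs.ofAbs a, rfl⟩
    · rintro ⟨x, rfl⟩; exact ⟨WithAbs.toAbs v x, rfl⟩
  rw [← hrange]
  exact ((isUniformInducing_ringHom_of_rpow_eq v ι hs h).isComplete_range).isClosed

/-- **Ostrowski's theorem, complete archimedean fields.** A field `K` complete with respect to a not non-archimedean
absolute value `v` is, as a valued field, `(ℝ, |·|^s)` or `(ℂ, ‖·‖^s)` for some `0 < s ≤ 1`: there is a field isomorphism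
`e : K ≃+* ℝ` with `v = |e(·)|^s`, or a field isomorphism `e : K ≃+* ℂ` with `v = ‖e(·)‖^s` (Ostrowski 1916; Neukirch,
*Algebraic Number Theory* II (4.2)). From `exists_ringHom_complex_rpow_eq` + closedness of the image + Mathlib's
`Complex.subfield_eq_of_closed`. [folklore] -/
theorem exists_ringEquiv_real_or_complex_of_completeSpace (v : AbsoluteValue K ℝ) (hv : ¬ IsNonarchimedean v)
    [CompleteSpace (WithAbs v)] :
    ∃ s : ℝ, 0 < s ∧ s ≤ 1 ∧
      ((∃ e : K ≃+* ℝ, ∀ x, v x = |e x| ^ s) ∨ (∃ e : K ≃+* ℂ, ∀ x, v x = ‖e x‖ ^ s)) := by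
  obtain ⟨ι, s, hs, hs1, h⟩ := exists_ringHom_complex_rpow_eq v hv
  refine ⟨s, hs, hs1, ?_⟩
  have hclosed : IsClosed (ι.fieldRange : Set ℂ) := by
    rw [RingHom.coe_fieldRange]
    exact isClosed_range_ringHom_of_rpow_eq v ι hs h
  rcases Complex.subfield_eq_of_closed hclosed with hR | hT
  · -- the image is `ℝ ⊆ ℂ`: `K ≃+* ℝ` through real parts
    left
    have hmem : ∀ x, ι x ∈ Complex.ofRealHom.fieldRange := fun x => hR ▸ RingHom.mem_fieldRange_self ι x
    have hre : ∀ x, ((ι x).re : ℂ) = ι x := fun x => by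
      obtain ⟨r, hr⟩ := RingHom.mem_fieldRange.mp (hmem x)
      rw [← hr, Complex.ofRealHom_eq_coe, Complex.ofReal_re]
    let g : K →+* ℝ :=
      { toFun := fun x => (ι x).re
        map_one' := by simp
        map_mul' := fun a b => by
          apply Complex.ofReal_injective
          rw [Complex.ofReal_mul, hre, hre, hre, map_mul]
        map_zero' := by simp
        map_add' := fun a b => by simp }
    have hg : ∀ x, ((g x : ℝ) : ℂ) = ι x := hre
    have hsurj : Function.Surjective g := fun r => by
      obtain ⟨x, hx⟩ := RingHom.mem_fieldRange.mp (hR.symm ▸ RingHom.mem_fieldRange_self Complex.ofRealHom r :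
        (r : ℂ) ∈ ι.fieldRange)
      refine ⟨x, ?_⟩
      apply Complex.ofReal_injective
      rw [hg, hx]
    refine ⟨RingEquiv.ofBijective g ⟨g.injective, hsurj⟩, fun x => ?_⟩
    rw [RingEquiv.ofBijective_apply, h x, ← hg, Complex.norm_real, Real.norm_eq_abs]
  · -- the image is all of `ℂ`
    right
    have hsurj : Function.Surjective ι := RingHom.fieldRange_eq_top_iff.mp hT
    exact ⟨RingEquiv.ofBijective ι ⟨ι.injective, hsurj⟩, fun x => by rw [RingEquiv.ofBijective_apply, h x]⟩

/-- The `ℂ` alternative is forced as soon as `-1` is a square in `K` (e.g. `K` algebraically closed): a complete, not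
non-archimedean valued field containing `√-1` is `(ℂ, ‖·‖^s)`, `0 < s ≤ 1`, up to a field isomorphism — the shape of
[J-II½] Def. 2.3.2. [folklore] -/
theorem exists_ringEquiv_complex_of_completeSpace_of_sq_eq_neg_one (v : AbsoluteValue K ℝ)
    (hv : ¬ IsNonarchimedean v) [CompleteSpace (WithAbs v)] {i : K} (hi : i ^ 2 = -1) :
    ∃ s : ℝ, 0 < s ∧ s ≤ 1 ∧ ∃ e : K ≃+* ℂ, ∀ x, v x = ‖e x‖ ^ s := by
  obtain ⟨s, hs, hs1, h | h⟩ := exists_ringEquiv_real_or_complex_of_completeSpace v hv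
  · exfalso
    obtain ⟨e, -⟩ := h
    have h1 : (e i) ^ 2 = -1 := by rw [← map_pow, hi, map_neg, map_one]
    have h2 : (0 : ℝ) ≤ (e i) ^ 2 := sq_nonneg _
    rw [h1] at h2
    norm_num at h2
  · exact ⟨s, hs, hs1, h⟩

/-- In particular for an algebraically closed `K`. [folklore] -/
theorem exists_ringEquiv_complex_of_completeSpace_of_isAlgClosed (v : AbsoluteValue K ℝ)
    (hv : ¬ IsNonarchimedean v) [CompleteSpace (WithAbs v)] [IsAlgClosed K] :
    ∃ s : ℝ, 0 < s ∧ s ≤ 1 ∧ ∃ e : K ≃+* ℂ, ∀ x, v x = ‖e x‖ ^ s := by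
  obtain ⟨i, hi⟩ := IsAlgClosed.exists_pow_nat_eq (-1 : K) two_pos
  exact exists_ringEquiv_complex_of_completeSpace_of_sq_eq_neg_one v hv hi

end Summit.ABC.IUTFork.Joshi.ArchimedeanOstrowski
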